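import Summits.ABC.IUTFork.Repair.RHQ3LTailHull
import Summits.ABC.IUTFork.Repair.RHQ3LTailSigma8
import Summits.ABC.IUTFork.Repair.RHHeightClassGlue
import HarnessLib

/-!
# D-0079 RESCUE sub-cell R-H, ROUND 2 Q3 — row 4 «hull-threshold-exact» in the l-TAIL: the POS-certificate by the DEEP member `log_p(1 + ϖ_w)`
# (radii `(r_in, r_out) := (1, r♯)`), so Q3(row 4) reads YES-PER-CURVE in the tail for the closed-form column (seat abc-iut-rh2-q3-typ-1 g2)

Companion of `RHQ3LTailHull` p470688 (abc-iut-rh2-q3-typ-1 g0: `hullCell_pilotDataOfK_of_ltail` — in the tail `HullCell e_w P j r_in r_out` for EVERY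
`1 ≤ r_in` and EVERY `r_out ≤ p^t − t·e_w`; word Q3(row 4) = CONDITIONAL «on `r_out(K_w) ≤ p^t − t·e_w`, R-W lane U») and of `RHQ3LTailSigma8` p478328
(`exists_strictMinPow_placeOf_of_lt`: in the tail every bad place is UNTIED). The instrument «TAIL ⟹ UNTIED» of abc-iut-lens-anomaly-2 g3 (STATUS
2026-08-27T00:46:22Z, staged `TailUntied.lean` ce3a0cfc10a70200, «for the Q3 typer/referee lane to land or decline») is LANDED here in the tree's
vocabulary. PROOF-ONLY up to ONE claim-tagged target `LTailSigma4Sharp` (the row-4 analogue of `RH.Q3LTail.LTailSigma3` / `LTailSigma8`). TAKES NO SIDE on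
[IUTchIII] Cor. 3.12 or on any author; nothing here asserts abc; `HullCell` / `HStarClosedForm` (abc-iut-rh-typ-4 p458452) are row 4's CANDIDATE column,
consumed BY NAME; «in Σ₄ (closed form)» = that hypothesis holds as typed with the stated radii, never «S holds».

THE POINT. `HullCell e m j r_in r_out := e·⌊(j²m − j(e−1) − (j+1)r_in)/e⌋ ≤ m − (j+1)·r_out` is MONOTONE in `r_in` and ANTITONE in `r_out`
(`RH.HullThresholdExact.hullCell_mono_rin` / `hullCell_anti_rout`), so the EXACT cell at the true radii `(r_in(K_w), r_out(K_w))` of `Λ_w = log_p 𝒪^×_{K_w}`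
(`𝔪^{r_in} ⊆ Λ_w ⊆ 𝔪^{r_out}`, hence `r_in ≥ 1` and `r_out ≤ v(z)` for every member `z ∈ Λ_w`) is POS-CERTIFIED by the cell at `(1, v(z))` for ANY member
`z`. R-W's shallow member `ϖ^{⌊e/(p−1)⌋+1}` is useless in the tail (`RHQ3LTailHull.not_hullCell_swapped_of_ltail`); the DEEP member `z = log_p(1 + ϖ_w)` has
valuation EXACTLY `r♯(p, e_w) = min_t (p^t − t·e_w)` when `e_w` is untied (abc-iut-c312-3's attained envelope, `RHHeightClassGlue.exists_mem_logUnits_rpow_le_of_certVal`),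
and in the tail every bad place IS untied (`p < l ∣ e_w`). Hence:
* `exists_deepMember_placeOf_of_lt` — `p < l` at a bad place `w | p`, `p > 2` ⟹ `∃ r`, `StrictMinPow p e_w r` ∧ (`∃ z ∈ log_p 𝒪^×_{K_w}`, `p^{−r/e_w} ≤ ‖z‖`)
  ∧ `∀ t, r ≤ p^t − t·e_w`;
* **`hStarClosedForm_pilotDataOfK_of_ltail_sharp`** — in the tail (`p^t ≤ l ∧ ord_v(q_v) + 4e(v|p) ≤ 4e(v|p)·t` at every bad place) there is a radii
  function `rout` CERTIFIED BY DEEP MEMBERS with `HStarClosedForm (pilotDataOfK D K) rin rout` for EVERY `rin ≥ 1` on the bad places — a POS-certificate for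
  the exact U2 cell at every cell of the datum (no «U2-LATTICE-INTEGERS» definition needed IN THE TAIL);
* TARGET `LTailSigma4Sharp F E` («∃ l₀(E) ∀ l ≥ l₀ ∀ Def. 3.1 data of level l over (F,E): such a certified `rout` exists») PROVED (`lTailSigma4Sharp_holds`,
  `l₀ := max_{v∣Δmin} p_v^{ord_v(Δ_min)+1}` as for rows 3/8) ⇒ Q3(row 4) = YES-PER-CURVE for the closed-form column with certified radii `(1, r♯)`, same
  exponential `l₀` scale; the identification «closed-form column = `HStarNu` cell» stays row 4's declared conjecture (U2-LICENCE-WRAPPER), untouched.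
[cite: Mochizuki2012, IUTchI Def. 3.1 (b)(c) pp. 61–62, Ex. 3.2 (iv) p. 71; IUTchIV Prop. 1.2 (i)(ii) p. 10, Prop. 1.4 p. 13]
[cite: NeukirchANT1999, Ch. II Prop. (5.5), (6.8)] [cite: SilvermanAEC2009, VII.5 Prop. 5.1(b), VIII.8] [claim: Mochizuki2012, status: disputed] for every IUT locution.
-/

noncomputable section

open Set Function NumberField IsDedekindDomain

namespace Summit.ABC.IUTFork.Repair.RH.Q3LTailHullSharp

open Literature.IUT.LogThetaLattice Literature.IUT.LogVolume Literature.IUT.HodgeTheaters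
  Literature.NumberTheory.GaloisRepresentations.Ultrametric
open Summit.ABC.IUTFork.Thm311 Summit.ABC.IUTFork.Thm311.Real Summit.ABC.IUTFork.Cor312Prov Summit.ABC.IUTFork.Repair.RHHeightClass
  Summit.ABC.IUTFork.Repair.RH.HullThresholdExact Summit.ABC.IUTFork.Repair.RH.Q3LTailHull Summit.ABC.IUTFork.Repair.RH.Q3LTailSigma8
  Summit.ABC.IUTFork.Repair.RH.Q3LTailBand

/-! ## §1. The exact cell from ANY member valuation and ANY inner radius `≥ 1` (monotonicity bookkeeping) -/

/-- **POS-CERTIFICATE SHAPE.** If the closed-form cell holds at `(1, r)` then it holds at every `(r_in, r_out)` with `1 ≤ r_in` and `r_out ≤ r` (`e > 0`,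
`j + 1 ≥ 0`): the true radii of `Λ_w` (`r_in(K_w) ≥ 1` since `Λ_w ⊆ 𝔪_w`; `r_out(K_w) ≤ v(z)` for a member `z`) inherit the cell from `(1, v(z))`.
(`hullCell_mono_rin` + `hullCell_anti_rout`.) [folklore] -/
theorem hullCell_of_one_member {e m j r rin rout : ℤ} (he : 0 < e) (hj : 0 ≤ j + 1) (hrin : 1 ≤ rin) (hrout : rout ≤ r)
    (h : HullCell e m j 1 r) : HullCell e m j rin rout :=
  hullCell_anti_rout hj hrout (hullCell_mono_rin he hj hrin h)

/-! ## §2. The deep member at an untied bad place of the genuine datum -/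

section Genuine

variable {F K Fbar : Type} [Field F] [NumberField F] [Field K] [NumberField K] [Algebra F K] [Field Fbar]
  [Algebra F Fbar] [Algebra K Fbar] {E : WeierstrassCurve F} [E.IsElliptic] {l : ℕ} {Pb : BadPlacePredicates K}
  (D : InitialThetaData F K Fbar E l Pb)

/-- **THE DEEP MEMBER IN THE TAIL.** At a bad place `w | p` of `pilotDataOfK D K` with `p < l` (so `e_w` is untied, `exists_strictMinPow_placeOf_of_lt`)
and `p > 2`: there is `r = r♯(p, e_w)` with `StrictMinPow p e_w r`, a unit logarithm `z ∈ log_p 𝒪^×_{K_w}` of norm `≥ p^{−r/e_w}` (abc-iut-c312-3's attained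
envelope via `RHHeightClassGlue.exists_mem_logUnits_rpow_le_of_certVal`), and `r ≤ p^t − t·e_w` for EVERY `t` (`strictMinPow_le_pow_sub`).
[cite: NeukirchANT1999, Ch. II Prop. (5.5), (6.8)] [cite: Mochizuki2012, IUTchI Ex. 3.2 (iv) p. 71] [claim: Mochizuki2012, status: disputed] -/
theorem exists_deepMember_placeOf_of_lt (pp : Nat.Primes) (hp2 : 2 < (pp : ℕ)) (w : (thetaIndex (pilotDataOfK D K)).Fibre (.inr pp))
    (hw : haveI : Fact (pp : ℕ).Prime := ⟨pp.2⟩; placeOf (pilotDataOfK D K) pp.1 w ∈ (pilotDataOfK D K).S)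
    (hpl : (pp : ℕ) < l) :
    haveI : Fact (pp : ℕ).Prime := ⟨pp.2⟩
    ∃ r : ℤ, StrictMinPow pp (ramIdx K (placeOf (pilotDataOfK D K) pp.1 w)) r ∧
      (∃ z ∈ (logUnits (kOf (pilotDataOfK D K) pp.1 w) : Set (kOf (pilotDataOfK D K) pp.1 w)),
        ((pp : ℕ) : ℝ) ^ (-(r : ℝ) / (ramIdx K (placeOf (pilotDataOfK D K) pp.1 w) : ℝ)) ≤ ‖z‖) ∧
      ∀ t : ℕ, r ≤ ((pp : ℕ) : ℤ) ^ t - t * (ramIdx K (placeOf (pilotDataOfK D K) pp.1 w) : ℕ) := by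
  haveI hF : Fact (pp : ℕ).Prime := ⟨pp.2⟩
  obtain ⟨a₀, -, -, hsmp⟩ := exists_strictMinPow_placeOf_of_lt D pp w hw hpl
  refine ⟨_, hsmp, ?_, fun t => strictMinPow_le_pow_sub hsmp t⟩
  exact RHHeightClassGlue.exists_mem_logUnits_rpow_le_of_certVal (pilotDataOfK D K) (pp : ℕ) hp2 w (Or.inl hsmp)

/-- **ROW 4 IN THE l-TAIL, POS-CERTIFIED BY DEEP MEMBERS.** If every bad place `w | p` of `pilotDataOfK D K` passes the tail test (`p^t ≤ l` and
`ord_v(q_v) + 4·e(v|p) ≤ 4·e(v|p)·t` for some `t`), then there is a radii function `rout` such that (i) at every bad place `rout(w) = r♯(p, e_w)` is untied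
(`StrictMinPow`) and ATTAINED by a member of `log_p 𝒪^×_{K_w}` of norm `≥ p^{−rout(w)/e_w}`, and (ii) `HStarClosedForm (pilotDataOfK D K) rin rout` for EVERY
inner-radius function with `rin ≥ 1` on the bad places — abc-iut-rh2-q3-typ-1 g0's `hStarClosedForm_pilotDataOfK_of_ltail` with its binder
`r_out(w) ≤ p^t − t·e_w` DISCHARGED by the deep member (the tail forces `p < l`, Def. 3.1 (b)(c) gives `p ≠ l`, `p > 2`). So in the tail the exact U2 cell is
POS at every cell of the datum for any true radii (`hullCell_of_one_member`). [cite: Mochizuki2012, IUTchI Def. 3.1 (b)(c) pp. 61–62, Ex. 3.2 (iv) p. 71;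
IUTchIV Prop. 1.2 (i)(ii) p. 10] [claim: Mochizuki2012, status: disputed] -/
theorem hStarClosedForm_pilotDataOfK_of_ltail_sharp
    (htail : ∀ (pp : Nat.Primes) (w : (thetaIndex (pilotDataOfK D K)).Fibre (.inr pp)),
      haveI : Fact (pp : ℕ).Prime := ⟨pp.2⟩
      placeOf (pilotDataOfK D K) pp.1 w ∈ (pilotDataOfK D K).S →
        ∃ t : ℕ, (pp : ℕ) ^ t ≤ l ∧
          qParamOrd E (finBelow F K (placeOf (pilotDataOfK D K) pp.1 w)) + 4 * ramIdx F (finBelow F K (placeOf (pilotDataOfK D K) pp.1 w)) ≤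
            4 * ramIdx F (finBelow F K (placeOf (pilotDataOfK D K) pp.1 w)) * t) :
    ∃ rout : ∀ pp : Nat.Primes, (thetaIndex (pilotDataOfK D K)).Fibre (.inr pp) → ℤ,
      (∀ (pp : Nat.Primes) (w : (thetaIndex (pilotDataOfK D K)).Fibre (.inr pp)),
        haveI : Fact (pp : ℕ).Prime := ⟨pp.2⟩
        placeOf (pilotDataOfK D K) pp.1 w ∈ (pilotDataOfK D K).S →
          StrictMinPow pp (ramIdx K (placeOf (pilotDataOfK D K) pp.1 w)) (rout pp w) ∧
          ∃ z ∈ (logUnits (kOf (pilotDataOfK D K) pp.1 w) : Set (kOf (pilotDataOfK D K) pp.1 w)),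
            ((pp : ℕ) : ℝ) ^ (-(rout pp w : ℝ) / (ramIdx K (placeOf (pilotDataOfK D K) pp.1 w) : ℝ)) ≤ ‖z‖) ∧
      ∀ rin : ∀ pp : Nat.Primes, (thetaIndex (pilotDataOfK D K)).Fibre (.inr pp) → ℤ,
        (∀ (pp : Nat.Primes) (w : (thetaIndex (pilotDataOfK D K)).Fibre (.inr pp)),
          haveI : Fact (pp : ℕ).Prime := ⟨pp.2⟩
          placeOf (pilotDataOfK D K) pp.1 w ∈ (pilotDataOfK D K).S → 1 ≤ rin pp w) →
        HStarClosedForm (pilotDataOfK D K) rin rout := by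
  classical
  -- `2 < p < l` at every bad place
  have hpl : ∀ (pp : Nat.Primes) (w : (thetaIndex (pilotDataOfK D K)).Fibre (.inr pp)),
      haveI : Fact (pp : ℕ).Prime := ⟨pp.2⟩
      placeOf (pilotDataOfK D K) pp.1 w ∈ (pilotDataOfK D K).S → 2 < (pp : ℕ) ∧ (pp : ℕ) < l := by
    intro pp w hw
    haveI : Fact (pp : ℕ).Prime := ⟨pp.2⟩
    obtain ⟨t, hpt, hn⟩ := htail pp w hw
    have hne := ne_two_and_ne_l_of_placeOf_mem_S_pilotDataOfK D pp w hw
    have h2 := pp.2.two_le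
    have ht1 : 1 ≤ t := by
      by_contra h0
      have : t = 0 := by omega
      subst this
      have he : 1 ≤ ramIdx F (finBelow F K (placeOf (pilotDataOfK D K) pp.1 w)) :=
        Nat.one_le_iff_ne_zero.2 (ramIdx_ne_zero F _)
      omega
    have hple : (pp : ℕ) ≤ l := le_trans (by
      calc (pp : ℕ) = (pp : ℕ) ^ 1 := (pow_one _).symm
        _ ≤ (pp : ℕ) ^ t := Nat.pow_le_pow_right pp.2.pos ht1) hpt
    omega
  -- choose the deep member's valuation at every bad place (any value elsewhere)
  let rout : ∀ pp : Nat.Primes, (thetaIndex (pilotDataOfK D K)).Fibre (.inr pp) → ℤ := fun pp w =>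
    haveI : Fact (pp : ℕ).Prime := ⟨pp.2⟩
    if hw : placeOf (pilotDataOfK D K) pp.1 w ∈ (pilotDataOfK D K).S then
      (exists_deepMember_placeOf_of_lt D pp (hpl pp w hw).1 w hw (hpl pp w hw).2).choose
    else 0
  have hspec : ∀ (pp : Nat.Primes) (w : (thetaIndex (pilotDataOfK D K)).Fibre (.inr pp)),
      haveI : Fact (pp : ℕ).Prime := ⟨pp.2⟩
      ∀ hw : placeOf (pilotDataOfK D K) pp.1 w ∈ (pilotDataOfK D K).S,
        rout pp w = (exists_deepMember_placeOf_of_lt D pp (hpl pp w hw).1 w hw (hpl pp w hw).2).choose := by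
    intro pp w hw
    simp only [rout, dif_pos hw]
  refine ⟨rout, fun pp w hw => ?_, fun rin hrin => ?_⟩
  · haveI : Fact (pp : ℕ).Prime := ⟨pp.2⟩
    have h := (exists_deepMember_placeOf_of_lt D pp (hpl pp w hw).1 w hw (hpl pp w hw).2).choose_spec
    rw [hspec pp w hw]
    exact ⟨h.1, h.2.1⟩
  · refine hStarClosedForm_pilotDataOfK_of_ltail D rin rout fun pp w hw => ?_
    haveI : Fact (pp : ℕ).Prime := ⟨pp.2⟩
    obtain ⟨t, hpt, hn⟩ := htail pp w hw
    have h := (exists_deepMember_placeOf_of_lt D pp (hpl pp w hw).1 w hw (hpl pp w hw).2).choose_spec.2.2 t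
    refine ⟨t, hpt, hn, hrin pp w hw, ?_⟩
    rw [hspec pp w hw, ← ramIdx_eq K]
    exact h

end Genuine

/-! ## §3. The per-curve target and its proof -/

section Target

variable (F : Type) [Field F] [NumberField F] (E : WeierstrassCurve F) [E.IsElliptic]

/-- **Q3 TARGET, ROW 4 — closed-form column with DEEP-MEMBER radii (per-curve l-tail)** [R-H round 2, kernel target]: «∃ l₀(E), ∀ l ≥ l₀, for EVERY
[IUTchI] Def. 3.1 initial Θ-datum of level `l` over `(F, E_F)` there is an outer-radius function `rout`, untied (`StrictMinPow`) and ATTAINED by a unit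
logarithm at every bad place, with abc-iut-rh-typ-4's `RH.HullThresholdExact.HStarClosedForm (pilotDataOfK D K) rin rout` for every `rin ≥ 1` on the bad
places» — i.e. the exact U2 cell is POS-certified at every cell of the datum (`hullCell_of_one_member`). The column's identification with the `HStarNu` cell
is row 4's declared conjecture and is NOT asserted. PROVED below. [R-H target over a HYPOTHESIS column — not a fact about S]
[cite: Mochizuki2012, IUTchI Def. 3.1 pp. 61–63; IUTchIV Prop. 1.2 (i)(ii) p. 10] [claim: Mochizuki2012, status: disputed] -/
@[claim "Mochizuki2012" "disputed"]
def LTailSigma4Sharp : Prop :=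
  ∃ l₀ : ℕ, ∀ l : ℕ, l₀ ≤ l →
    ∀ (K Fbar : Type) [Field K] [NumberField K] [Algebra F K] [Field Fbar] [Algebra F Fbar] [Algebra K Fbar]
      (Pb : BadPlacePredicates K) (D : InitialThetaData F K Fbar E l Pb),
      ∃ rout : ∀ pp : Nat.Primes, (thetaIndex (pilotDataOfK D K)).Fibre (.inr pp) → ℤ,
        (∀ (pp : Nat.Primes) (w : (thetaIndex (pilotDataOfK D K)).Fibre (.inr pp)),
          haveI : Fact (pp : ℕ).Prime := ⟨pp.2⟩
          placeOf (pilotDataOfK D K) pp.1 w ∈ (pilotDataOfK D K).S →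
            StrictMinPow pp (ramIdx K (placeOf (pilotDataOfK D K) pp.1 w)) (rout pp w) ∧
            ∃ z ∈ (logUnits (kOf (pilotDataOfK D K) pp.1 w) : Set (kOf (pilotDataOfK D K) pp.1 w)),
              ((pp : ℕ) : ℝ) ^ (-(rout pp w : ℝ) / (ramIdx K (placeOf (pilotDataOfK D K) pp.1 w) : ℝ)) ≤ ‖z‖) ∧
        ∀ rin : ∀ pp : Nat.Primes, (thetaIndex (pilotDataOfK D K)).Fibre (.inr pp) → ℤ,
          (∀ (pp : Nat.Primes) (w : (thetaIndex (pilotDataOfK D K)).Fibre (.inr pp)),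
            haveI : Fact (pp : ℕ).Prime := ⟨pp.2⟩
            placeOf (pilotDataOfK D K) pp.1 w ∈ (pilotDataOfK D K).S → 1 ≤ rin pp w) →
          HStarClosedForm (pilotDataOfK D K) rin rout

/-- **Q3(row 4, closed-form column with deep-member radii) = YES per curve**: `LTailSigma4Sharp F E` with `l₀ := max {p_v^{ord_v(Δ_min)+1} : ord_v(Δ_min) ≠ 0}`
(Silverman VIII.8 finiteness; every bad place of a Def. 3.1 datum is multiplicative), by `hStarClosedForm_pilotDataOfK_of_ltail_sharp` with `t := ord_v(q_v) + 1`
at every bad place. Same EXPONENTIAL `l₀` scale as rows 3/8 (`RH.Q3LTail.lTailSigma3_holds`, `RH.Q3LTailSigma8.lTailSigma8_holds`).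
[cite: SilvermanAEC2009, VII.5 Prop. 5.1(b), VIII.8] [claim: Mochizuki2012, status: disputed] -/
theorem lTailSigma4Sharp_holds : LTailSigma4Sharp F E := by
  classical
  have hfin : {v : HeightOneSpectrum (𝓞 F) | E.ordMinimalDiscriminant v ≠ 0}.Finite :=
    E.finite_setOf_ordMinimalDiscriminant_ne_zero_holds (A := 𝓞 F)
  refine ⟨hfin.toFinset.sup (fun v => residueChar F v ^ (qParamOrd E v + 1)), fun l hl K Fbar _ _ _ _ _ _ Pb D => ?_⟩
  refine hStarClosedForm_pilotDataOfK_of_ltail_sharp D fun pp w hw => ?_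
  haveI : Fact (pp : ℕ).Prime := ⟨pp.2⟩
  set v := finBelow F K (placeOf (pilotDataOfK D K) pp.1 w) with hv
  have hVF : FinitePlace.mk v ∈ D.VFbad := (mem_pilotDataOfK_S_iff D K _).mp hw
  have hmult : E.HasMultiplicativeReductionAt v := ThetaData.hasMultiplicativeReductionAt_under_of_mem_VFbad D hVF
  have hne : E.ordMinimalDiscriminant v ≠ 0 := E.ordMinimalDiscriminant_ne_zero_of_hasMultiplicativeReductionAt v hmult
  have hvS : v ∈ hfin.toFinset := by
    rw [Set.Finite.mem_toFinset]
    exact hne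
  have hres : residueChar F v = (pp : ℕ) := by
    rw [hv, residueChar_finBelow]
    exact residueChar_eq_of_natCast_mem (pp : ℕ) (natCast_mem_placeOf (pilotDataOfK D K) pp.1 w)
  refine ⟨qParamOrd E v + 1, ?_, ?_⟩
  · calc (pp : ℕ) ^ (qParamOrd E v + 1) = residueChar F v ^ (qParamOrd E v + 1) := by rw [hres]
      _ ≤ hfin.toFinset.sup (fun v => residueChar F v ^ (qParamOrd E v + 1)) :=
          Finset.le_sup (f := fun v => residueChar F v ^ (qParamOrd E v + 1)) hvS
      _ ≤ l := hl
  · have he : 1 ≤ ramIdx F v := Nat.one_le_iff_ne_zero.mpr (ramIdx_ne_zero F v)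
    nlinarith [he, Nat.zero_le (qParamOrd E v)]

end Target

end Summit.ABC.IUTFork.Repair.RH.Q3LTailHullSharp

end
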